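import Literature.IUT.HodgeArakelov.LabelClassesOfCuspsCor24iiAssembly
import Literature.IUT.HodgeArakelov.LabelClassesOfCuspsCor24iOfSpecialFibre
import Literature.IUT.HodgeTheaters.StableCurveTemperedDataOfSpecialFibreTowerComplete
import Literature.IUT.HodgeTheaters.TemperedCoveringsSubgraphClosures
import HarnessLib

/-!
# [IUTchII] Cor. 2.4 (ii)(iii)′ — the node's closing theorems with their [IUTchI] §2 FACT binders SUPPLIED BY PRODUCERS:
# (1) Cor. 2.4 (i) by `cor24_i_of_inputs`; (2) Prop. 2.4 (i), Cor. 2.3 (ii), (iii), (v) at the GENUINE datum `ofSpecialFibre X d S …`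
# (proof-only; C-R33 / K4 RE-CLOSE sibling, node `IUTchII:Cor2.4(ii)`)

S. Mochizuki, *Inter-universal Teichmüller theory II*, kurims manuscript (Dec. 2020), §2, Cor. 2.4 (i) pp. 69–71, (ii)(iii)
p. 70, Def. 2.3 (i)/(ii) pp. 67–68 [claim: Mochizuki2012, status: disputed] (IUTchII §2 Cor 2.4 (ii), kurims p.70; D-0012 claim
key — NOTHING of the series is asserted here); *Inter-universal Teichmüller theory I* (kurims, May 2020) §2, Cor. 2.3 (ii),
(iii), (v) pp. 47–48, Prop. 2.4 (i) p. 50, Cor. 2.5 p. 51 [claim: Mochizuki2012, status: disputed] (IUTchI §2 Cor 2.3, kurims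
p.47); [SemiAnbd] §6 p. 69 [cite: MochizukiSemiAnbd2006, Ex 3.10 pp.44-45].
Cell `abc-iut`, seat abc-iut-w5-d162 (gen 7); R-C letter K / plan C-R33 «K4 RE-CLOSE», row «K4-RECLOSE-L6-IUTchII»
(abc-iut-c312-2 `CONE-K4-RECLOSE.tsv` v3: node `IUTchII:Cor2.4(ii)`, class RECLOSABLE, refuted-closure binders
F-1949 `Cor24_i` (closers `cor24_ii_iii'_of_inputs` / `cuspDecomp_one_le_box_of_cor24_i`, abc-iut-w4-d012,
`LabelClassesOfCuspsCor24iiProofs.lean`) and F-2599 `Prop24i` · F-2593 `Cor23ii` · F-2595 `Cor23iii` · F-2597 `Cor23v`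
(closers `cor24_ii_iii'_of_agreement` / `cor24_ii_iii'_tri_of_agreement`, abc-iut-w4-d012 g?, `LabelClassesOfCuspsCor24iiAssembly.lean`);
CLOSED producers: `cor24_i_of_inputs` (abc-iut-w4-d012, `LabelClassesOfCuspsCor24iProofs.lean`), and, at abc-iut-L5-t11's genuine
constructor `StableCurveTemperedData.ofSpecialFibre X d S h36 …`: `OfSpecialFibre.prop24i_ofPiData_of_admKer_nhds_one`
(abc-iut-w4-d063 lineage, `…OfSpecialFibreTowerComplete.lean`), `cor23ii_ofSpecialFibre` (abc-iut-L5-t11,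
`TemperedCoveringsCor23iiOfSpecialFibre.lean`), `cor23iii_ofSpecialFibre_of_slim_of_outerTp` (ibid.; binds [IUTchI] Cor. 2.3 (i)
= F-2592, class CONDITIONAL, not refuted-closure), `cor23v_of_graph` (abc-iut-L5-t11, `TemperedCoveringsSubgraphClosures.lean`)).
PROOF-ONLY: no definition, no instance, no new named fact; the original closers and every producer are consumed BY NAME.

WHAT IS PROVED.
* §1 `cuspDecomp_one_le_box_of_inputsABC` / `cor24_ii_iii'_of_inputsABC` — the sub-DAG assembly of Cor. 2.4 (ii)(iii)′ with
  its Cor. 2.4 (i) binder (F-1949, whose ∀-closure is REFUTED in the tree, `exists_plusMinusTower_not_cor24_i`) replaced by the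
  three printed inputs (A) [IUTchI] Cor. 2.5, (B) Cor. 2.3 (vi), (C) Cor. 2.3 (v) in tower language, per cuspidal `I ⊆ Δ_{v□}` —
  i.e. the closers composed with the CLOSED producer `cor24_i_of_inputs`; ZERO FACT heads (all hypotheses are inline printed
  clauses), for EVERY tower `W`, cuspidal datum `C`, `Π_{v□} := H`;
* §2 `cor24_ii_iii'_ofSpecialFibre_of_agreement_ofPiData` / `…_tri_…` — the node-level closer over the tower↔[IUTchI] §2
  agreement `A` at the GENUINE datum `Dsc := ofSpecialFibre X d S h36 Σ Σ̂ … Π_ℍ Π̂_ℍ … cuspMeetsH`, with `h24i` SUPPLIED by the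
  Π-equivariant special-fibre tower producer (per-level printed inputs `hstf` · `hA3` · `hspec` · `hadm`, verticial/node DATA),
  `h23ii` by `cor23ii_ofSpecialFibre` (`Π̂_ℍ` = closure of `Π^tp_ℍ`, `hHcl`), `h23v` by `cor23v_of_graph` («`Π̂_ℍ ∩ Π^tp_𝔾 = Π^tp_ℍ`»,
  `hv`), `h23iii` by `cor23iii_ofSpecialFibre_of_slim_of_outerTp` (inputs: [IUTchI] Cor. 2.3 (i) of the datum = F-2592
  CONDITIONAL class, slimness of `Δ̂_{X,ℍ}` under `Cor23Hyp`, outer `G_K`-stability of `ℍ`), and the Rmk. 2.4.1 datum `hΛ` by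
  abc-iut-w5-d121/L5-t11's `hΛ_ofSpecialFibre` («`I_x ≅ Ẑ(1)`») — ZERO refuted-closure FACT heads remain; the other binders
  (`Cor24_family`, `Dic` = F-2734 SubgraphDictionary DATA, `hBox`, the open-subgroup step (B) `h23vi` = GAP-LEDGER G-w4d012-2,
  (E) `hcap`, (a.2) `hYdd`, `Cor23Hyp`) stay exactly as abc-iut-w4-d012 typed them.
Node-level reading (C-R33): at the genuine carrier `ofSpecialFibre …` every closing theorem of the node holds with its
refuted-closure binders replaced by the producers' printed inputs.

HONEST LIMITS: tower/agreement data (`W`, `C`, `Dec`, `Ld`, `A`), the special-fibre DATA of `X` and the producers' per-level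
inputs stay HYPOTHESES/DATA exactly as their authors typed them (agreements at the genuine pair EXIST: abc-iut-w5-d132's
`exists_stableCurveAgreement_ofPiCHat_ofSpecialFibre`; producer-package non-vacuity: abc-iut-f-193's
`exists_ofSpecialFibre_input_prop24`); re-closed-at-a-carrier ≠ proved-in-print; no side is taken on [IUTchIII] Cor. 3.12;
typed ≠ proved; nothing here says abc is proved or refuted.
-/

noncomputable section

namespace Literature.IUT.HodgeArakelov

open Literature.IUT.HodgeTheaters Literature.AnabelianGeometry.SemiGraphs
open Literature.AnabelianGeometry.SemiGraphs.ProfiniteSemiGraph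
open Literature.IUT.HodgeTheaters.StableCurveTemperedData
open Literature.AlgebraicGeometry.Frobenioids (IsSlimGroup)
open _root_.Topology
open scoped Pointwise

universe u

/-! ### §1. The Cor. 2.4 (i) binder (F-1949) supplied by `cor24_i_of_inputs` -/

section InputsABC

variable {S : BadPlaceSetting.{u}} {P : TopGroup.{u}} {T : TemperedCoverings S P}
  {W : PlusMinusTower T} {C : CuspidalInertiaData W} {H : Subgroup P}

/-- **IUTchII:Cor2.4(ii) (a), sub-node (a.1) «`D_t ⊆ Π_{v□}`», its Cor. 2.4 (i) binder SUPPLIED** — abc-iut-w4-d012's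
`cuspDecomp_one_le_box_of_cor24_i` composed with the CLOSED producer `cor24_i_of_inputs`: from, for every `Π_v`-cuspidal
`I ⊆ Δ_{v□}`, (A) «`γ' ∈ Δ̂^±_v`, `I^{γ'} ⊆ Π^±_v ⟹ γ' ∈ Π^±_v`» ([IUTchI] Cor. 2.5), (B) «`γ' ∈ Δ^±_v`, `I^{γ'} ⊆ Π^±_{v□} ⟹
γ' ∈ cl(Δ^±_{v□})`» (Cor. 2.3 (vi) at open subgroups) and (C) «`cl(Δ^±_{v□}) ∩ Δ^±_v ⊆ Δ^±_{v□}`» (Cor. 2.3 (v)), together with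
(S) `hsurj` and (E) `hcap`, the decomposition group `D_t = N_{Π_v}(I_t)` lies in `Π_{v□}`.  ZERO FACT heads.
[claim: Mochizuki2012, status: disputed] (IUTchII §2 Cor 2.4 (ii), kurims p.70) -/
theorem cuspDecomp_one_le_box_of_inputsABC
    (h25 : ∀ I : Subgroup W.Corhat, C.IsCuspidalInertia W.piV I → I ≤ W.deltaBox H →
      ∀ γ' : W.Corhat, γ' ∈ W.pmHat ⊓ W.aug.ker → I.map (MulAut.conj γ').toMonoidHom ≤ W.piPM → γ' ∈ W.piPM)
    (h23vi : ∀ I : Subgroup W.Corhat, C.IsCuspidalInertia W.piV I → I ≤ W.deltaBox H →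
      ∀ γ' : W.Corhat, γ' ∈ W.piPM ⊓ W.aug.ker →
        I.map (MulAut.conj γ').toMonoidHom ≤ W.pmBox H → γ' ∈ closure (W.deltaPmBox H : Set W.Corhat))
    (h23v : ∀ γ' : W.Corhat, γ' ∈ W.piPM ⊓ W.aug.ker →
      γ' ∈ closure (W.deltaPmBox H : Set W.Corhat) → γ' ∈ W.deltaPmBox H)
    (hsurj : ∀ n : W.Corhat, n ∈ W.piV → ∃ m : W.Corhat, m ∈ W.pmBox H ∧ m⁻¹ * n ∈ W.aug.ker)
    (hcap : W.pmBox H ⊓ W.piV ≤ W.box H)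
    {I : Subgroup W.Corhat} (hI : C.IsCuspidalInertia W.piV I) (hIΔ : I ≤ W.deltaBox H) :
    W.cuspDecomp I 1 ≤ W.box H :=
  cuspDecomp_one_le_box_of_cor24_i
    (fun I hI hIΔ => cor24_i_of_inputs W C H I (h25 I hI hIΔ) (h23vi I hI hIΔ) h23v) hsurj hcap hI hIΔ

/-- **IUTchII:Cor2.4(ii)(iii)′, its Cor. 2.4 (i) binder (F-1949) SUPPLIED** — abc-iut-w4-d012's assembly `cor24_ii_iii'_of_inputs`
composed with the CLOSED producer `cor24_i_of_inputs`: the typed statement of record `Cor24_ii_iii' W C H` from the per-`I`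
printed inputs (A) [IUTchI] Cor. 2.5, (B) Cor. 2.3 (vi), (C) Cor. 2.3 (v), (S) `hsurj`, (E) `hcap` and the sub-node (a.2) `hYdd`
— ZERO FACT heads, every tower `W`, cuspidal datum `C`, `Π_{v□} := H`. [claim: Mochizuki2012, status: disputed]
(IUTchII §2 Cor 2.4 (ii), kurims p.70) -/
theorem cor24_ii_iii'_of_inputsABC
    (h25 : ∀ I : Subgroup W.Corhat, C.IsCuspidalInertia W.piV I → I ≤ W.deltaBox H →
      ∀ γ' : W.Corhat, γ' ∈ W.pmHat ⊓ W.aug.ker → I.map (MulAut.conj γ').toMonoidHom ≤ W.piPM → γ' ∈ W.piPM)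
    (h23vi : ∀ I : Subgroup W.Corhat, C.IsCuspidalInertia W.piV I → I ≤ W.deltaBox H →
      ∀ γ' : W.Corhat, γ' ∈ W.piPM ⊓ W.aug.ker →
        I.map (MulAut.conj γ').toMonoidHom ≤ W.pmBox H → γ' ∈ closure (W.deltaPmBox H : Set W.Corhat))
    (h23v : ∀ γ' : W.Corhat, γ' ∈ W.piPM ⊓ W.aug.ker →
      γ' ∈ closure (W.deltaPmBox H : Set W.Corhat) → γ' ∈ W.deltaPmBox H)
    (hsurj : ∀ n : W.Corhat, n ∈ W.piV → ∃ m : W.Corhat, m ∈ W.pmBox H ∧ m⁻¹ * n ∈ W.aug.ker)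
    (hcap : W.pmBox H ⊓ W.piV ≤ W.box H)
    (hYdd : ∀ I : Subgroup W.Corhat, C.IsCuspidalInertia W.piV I → I ≤ W.deltaBox H →
      W.cuspDecomp I 1 ≤ (T.YddL).map (W.emb.comp T.incl)) :
    Literature.IUT.HodgeArakelov.Cor24_ii_iii' W C H :=
  cor24_ii_iii'_of_inputs
    (fun I hI hIΔ => cor24_i_of_inputs W C H I (h25 I hI hIΔ) (h23vi I hI hIΔ) h23v) hsurj hcap hYdd

end InputsABC

/-! ### §2. The node-level closer over the agreement AT THE GENUINE datum `ofSpecialFibre X d S …` -/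

section OfSpecialFibre

variable {S : BadPlaceSetting.{0}} {P : TopGroup.{0}} {T : TemperedCoverings S P}
  {Det : EtaleThetaData S.toThetaSetting P} (Dec : SubgraphDecomposition S T Det) (W : PlusMinusTower T)
  (Cu : CuspidalInertiaData W) {L : LabCuspStructure Cu} (Ld : LabelledDecomposition Dec L) (H : Subgroup P)
  {p : ℕ} [Fact p.Prime] {X : TemperedCurve p} {d : X.GroupLevelData}
  {Sf : SpecialFibreData (X.toTemperedArithmeticGroup d)} {h36 : Sf.Gc.Prop36Hypotheses}
  {Sigma SigmaHat : Set ℕ} {hsub : Sigma ⊆ SigmaHat} {hne : Sigma.Nonempty}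
  {hprime : ∀ q ∈ SigmaHat, q.Prime} {hp : p ∉ Sigma} {TpH : Subgroup Sf.chart.G}
  {HatH : Subgroup (TemperedGraphGroupData.exists_completion_of_prop36 Sf.Gc h36 Sf.chart).choose}
  {hle : TpH.map (TemperedGraphGroupData.exists_completion_of_prop36 Sf.Gc h36
    Sf.chart).choose_spec.choose.toMonoidHom ≤ HatH}
  {cMH : {x : X.Pt // X.IsCusp x} → Prop}

/-- **IUTchII:Cor2.4(ii)(iii)′ — node-level closer over the agreement AT THE GENUINE [IUTchI] §2 datum, its four refuted-closure
binders SUPPLIED** (K4 RE-CLOSE sibling of abc-iut-w4-d012's `cor24_ii_iii'_of_agreement` at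
`Dsc := StableCurveTemperedData.ofSpecialFibre X d S h36 Σ Σ̂ … Π_ℍ Π̂_ℍ … cuspMeetsH`): for an admissible `Π_{v□}` (`Cor24_family`) and
ANY agreement `A` of `(W, C)` with the genuine datum, the typed statement of record `Cor24_ii_iii' W C H` follows from — in place of
[IUTchI] Prop. 2.4 (i), Cor. 2.3 (ii), (iii), (v) of an abstract datum — the PRODUCERS' printed inputs: the Π-equivariant
special-fibre tower `Tw`/`Pw` with `hstf` · `hA3` · `hspec` · `hadm` and verticial/node DATA (⟹ Prop. 2.4 (i),
`prop24i_ofPiData_of_admKer_nhds_one`), `hHcl` («`Π̂_ℍ` is the closure of `Π^tp_ℍ`» ⟹ Cor. 2.3 (ii), `cor23ii_ofSpecialFibre`), `hv`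
(«`Π̂_ℍ ∩ Π^tp_𝔾 = Π^tp_ℍ`» ⟹ Cor. 2.3 (v), `cor23v_of_graph`), `hi` ([IUTchI] Cor. 2.3 (i) of the datum — F-2592, CONDITIONAL class),
`hslim` (slimness of `Δ̂_{X,ℍ}` under `Cor23Hyp`) and `hOutTp` (outer `G_K`-stability of `ℍ`) (⟹ Cor. 2.3 (iii),
`cor23iii_ofSpecialFibre_of_slim_of_outerTp`); the Rmk. 2.4.1 datum `hΛ` is abc-iut-w5-d121/L5-t11's THEOREM `hΛ_ofSpecialFibre`
(`hfi`, `hlev`).  The remaining binders are abc-iut-w4-d012's verbatim (`hHyp`, `Dic`, `hBox`, `h23vi`, `hcap`, `hYdd`).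
ZERO refuted-closure FACT heads. [claim: Mochizuki2012, status: disputed] (IUTchII §2 Cor 2.4 (ii), kurims p.70) -/
theorem cor24_ii_iii'_ofSpecialFibre_of_agreement_ofPiData (hH : Cor24_family Dec Ld H)
    (A : W.StableCurveAgreement Cu
      (StableCurveTemperedData.ofSpecialFibre X d Sf h36 Sigma SigmaHat hsub hne hprime hp TpH HatH hle cMH))
    (hfi : (W.piV.subgroupOf W.piPM).index ≠ 0)
    (hlev : ∀ (Q I : Subgroup W.Corhat), Cu.IsCuspidalInertia Q I ↔
      I ≤ Q ∧ ∃ I₀ : Subgroup W.Corhat, Cu.IsCuspidalInertia W.piPM I₀ ∧ I = I₀ ⊓ Q)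
    -- producer inputs for [IUTchI] Prop. 2.4 (i) at the datum
    (Tw : SpecialFibreTower X.DeltaTemp) (Pw : SpecialFibreTower.PiData X d Sf Tw)
    (hstf : (StableCurveTemperedData.ofSpecialFibre X d Sf h36 Sigma SigmaHat hsub hne hprime hp TpH HatH hle
      cMH).StronglyTorsionFreeSigma)
    (Λv : ∀ i, (Tw.Gc i).graph.Vertex → Subgroup (Tw.chart i).G)
    (hΛv : ∀ i v, Λv i v ∈ verticialSubgroups (Tw.chart i) v)
    (E : ℕ → Type) (src tgt : ∀ i, E i → (Tw.Gc i).graph.Vertex) (c₁ c₂ : ∀ i, E i → (Tw.chart i).G)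
    (hA3 : ∀ i (v w : (Tw.Gc i).graph.Vertex) (g h : (OfSpecialFibre.levelGraph X Tw Sigma SigmaHat hsub hne hprime i).Hat),
      MulAut.conj g • (Λv i v).map (OfSpecialFibre.levelGraph X Tw Sigma SigmaHat hsub hne hprime i).ι ⊓
          MulAut.conj h • (Λv i w).map (OfSpecialFibre.levelGraph X Tw Sigma SigmaHat hsub hne hprime i).ι ≠ ⊥ →
        (v = w ∧ g⁻¹ * h ∈ (Λv i v).map (OfSpecialFibre.levelGraph X Tw Sigma SigmaHat hsub hne hprime i).ι) ∨
        ∃ (e : E i) (k : (OfSpecialFibre.levelGraph X Tw Sigma SigmaHat hsub hne hprime i).Hat),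
          ∃ p ∈ (Λv i (src i e)).map (OfSpecialFibre.levelGraph X Tw Sigma SigmaHat hsub hne hprime i).ι,
          ∃ q ∈ (Λv i (tgt i e)).map (OfSpecialFibre.levelGraph X Tw Sigma SigmaHat hsub hne hprime i).ι,
            (src i e = v ∧ tgt i e = w ∧
                g = k * (OfSpecialFibre.levelGraph X Tw Sigma SigmaHat hsub hne hprime i).ι (c₁ i e) * p ∧
                h = k * (OfSpecialFibre.levelGraph X Tw Sigma SigmaHat hsub hne hprime i).ι (c₂ i e) * q) ∨
            (src i e = w ∧ tgt i e = v ∧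
                h = k * (OfSpecialFibre.levelGraph X Tw Sigma SigmaHat hsub hne hprime i).ι (c₁ i e) * p ∧
                g = k * (OfSpecialFibre.levelGraph X Tw Sigma SigmaHat hsub hne hprime i).ι (c₂ i e) * q))
    (hspec : (OfSpecialFibre.towerOfSpecialFibreTower X d Tw Sigma SigmaHat hsub hne hprime Sf h36 hp TpH HatH hle
      cMH).SpecializationAb)
    (hadm : ∀ U ∈ 𝓝 (1 : ↥X.DeltaTemp), ∃ j, ((Tw.admKer j : Subgroup ↥X.DeltaTemp) : Set ↥X.DeltaTemp) ⊆ U)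
    -- producer input for Cor. 2.3 (ii): `Π̂_ℍ` is the closure of `Π^tp_ℍ`
    (hHcl : ((StableCurveTemperedData.ofSpecialFibre X d Sf h36 Sigma SigmaHat hsub hne hprime hp TpH HatH hle cMH).graph.HatH :
        Set (StableCurveTemperedData.ofSpecialFibre X d Sf h36 Sigma SigmaHat hsub hne hprime hp TpH HatH hle cMH).graph.Hat) =
      closure ((StableCurveTemperedData.ofSpecialFibre X d Sf h36 Sigma SigmaHat hsub hne hprime hp TpH HatH hle cMH).graph.ι ''
        (StableCurveTemperedData.ofSpecialFibre X d Sf h36 Sigma SigmaHat hsub hne hprime hp TpH HatH hle cMH).graph.TpH))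
    -- producer input for Cor. 2.3 (v): `Π̂_ℍ ∩ Π^tp_𝔾 = Π^tp_ℍ`
    (hv : ((StableCurveTemperedData.ofSpecialFibre X d Sf h36 Sigma SigmaHat hsub hne hprime hp TpH HatH hle cMH).graph.HatH :
        Set (StableCurveTemperedData.ofSpecialFibre X d Sf h36 Sigma SigmaHat hsub hne hprime hp TpH HatH hle cMH).graph.Hat) ∩
        Set.range (StableCurveTemperedData.ofSpecialFibre X d Sf h36 Sigma SigmaHat hsub hne hprime hp TpH HatH hle cMH).graph.ι =
      (StableCurveTemperedData.ofSpecialFibre X d Sf h36 Sigma SigmaHat hsub hne hprime hp TpH HatH hle cMH).graph.ι ''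
        (StableCurveTemperedData.ofSpecialFibre X d Sf h36 Sigma SigmaHat hsub hne hprime hp TpH HatH hle cMH).graph.TpH)
    -- producer inputs for Cor. 2.3 (iii): Cor. 2.3 (i) of the datum (F-2592, conditional), slimness, outer stability
    (hi : (StableCurveTemperedData.ofSpecialFibre X d Sf h36 Sigma SigmaHat hsub hne hprime hp TpH HatH hle cMH).Cor23i)
    (hslim : (StableCurveTemperedData.ofSpecialFibre X d Sf h36 Sigma SigmaHat hsub hne hprime hp TpH HatH hle cMH).Cor23Hyp →
      IsSlimGroup (StableCurveTemperedData.ofSpecialFibre X d Sf h36 Sigma SigmaHat hsub hne hprime hp TpH HatH hle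
        cMH).deltaHatH)
    (hOutTp : ∀ g : (StableCurveTemperedData.ofSpecialFibre X d Sf h36 Sigma SigmaHat hsub hne hprime hp TpH HatH hle cMH).PiTp,
      ∃ δ : (StableCurveTemperedData.ofSpecialFibre X d Sf h36 Sigma SigmaHat hsub hne hprime hp TpH HatH hle cMH).DeltaTp,
        MulAut.conj g • ((StableCurveTemperedData.ofSpecialFibre X d Sf h36 Sigma SigmaHat hsub hne hprime hp TpH HatH hle
            cMH).deltaTpH.map
          (StableCurveTemperedData.ofSpecialFibre X d Sf h36 Sigma SigmaHat hsub hne hprime hp TpH HatH hle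
            cMH).DeltaTp.subtype) =
        MulAut.conj (δ : (StableCurveTemperedData.ofSpecialFibre X d Sf h36 Sigma SigmaHat hsub hne hprime hp TpH HatH hle
            cMH).PiTp) •
          ((StableCurveTemperedData.ofSpecialFibre X d Sf h36 Sigma SigmaHat hsub hne hprime hp TpH HatH hle
              cMH).deltaTpH.map
            (StableCurveTemperedData.ofSpecialFibre X d Sf h36 Sigma SigmaHat hsub hne hprime hp TpH HatH hle
              cMH).DeltaTp.subtype))
    -- abc-iut-w4-d012's remaining binders, verbatim
    (hHyp : (StableCurveTemperedData.ofSpecialFibre X d Sf h36 Sigma SigmaHat hsub hne hprime hp TpH HatH hle cMH).Cor23Hyp)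
    (Dic : ∀ H' : Subgroup P, Cor24_family Dec Ld H' → A.SubgraphDictionary H')
    (hBox : ((W.pmBox H).subgroupOf W.pmHat).map A.eHat.toMonoidHom =
      (StableCurveTemperedData.ofSpecialFibre X d Sf h36 Sigma SigmaHat hsub hne hprime hp TpH HatH hle cMH).piTpXH.map
        (StableCurveTemperedData.ofSpecialFibre X d Sf h36 Sigma SigmaHat hsub hne hprime hp TpH HatH hle cMH).ιX)
    (h23vi : ∀ I : Subgroup W.Corhat, Cu.IsCuspidalInertia W.piV I → ∀ H' : Subgroup P, Cor24_family Dec Ld H' →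
      ∀ γ' : W.Corhat, γ' ∈ W.piPM ⊓ W.aug.ker →
        I.map (MulAut.conj γ').toMonoidHom ≤ W.pmBox H' → γ' ∈ closure (W.deltaPmBox H' : Set W.Corhat))
    (hcap : W.pmBox H ⊓ W.piV ≤ W.box H)
    (hYdd : ∀ I : Subgroup W.Corhat, Cu.IsCuspidalInertia W.piV I → I ≤ W.deltaBox H →
      W.cuspDecomp I 1 ≤ (T.YddL).map (W.emb.comp T.incl)) :
    Literature.IUT.HodgeArakelov.Cor24_ii_iii' W Cu H :=
  have h24i : (StableCurveTemperedData.ofSpecialFibre X d Sf h36 Sigma SigmaHat hsub hne hprime hp TpH HatH hle cMH).Prop24i :=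
    OfSpecialFibre.prop24i_ofPiData_of_admKer_nhds_one X d Tw Sigma SigmaHat hsub hne hprime Sf h36 hp TpH HatH hle cMH Pw
      hstf Λv hΛv E src tgt c₁ c₂ hA3 hspec hadm
  have h23ii : (StableCurveTemperedData.ofSpecialFibre X d Sf h36 Sigma SigmaHat hsub hne hprime hp TpH HatH hle cMH).Cor23ii :=
    StableCurveTemperedData.cor23ii_ofSpecialFibre X d Sf h36 Sigma SigmaHat hsub hne hprime hp TpH HatH hle cMH hHcl
  cor24_ii_iii'_of_agreement Dec W Cu Ld H hH A h24i h23ii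
    ((StableCurveTemperedData.ofSpecialFibre X d Sf h36 Sigma SigmaHat hsub hne hprime hp TpH HatH hle cMH).cor23v_of_graph hv)
    hHyp
    (StableCurveTemperedData.cor23iii_ofSpecialFibre_of_slim_of_outerTp X d Sf h36 Sigma SigmaHat hsub hne hprime hp TpH
      HatH hle cMH hi h23ii hslim hOutTp)
    (fun _ hI => A.hΛ_ofSpecialFibre hfi hlev hI) Dic hBox h23vi hcap hYdd

/-- **IUTchII:Cor2.4(ii)(iii)′ for `□ = ▶` AT THE GENUINE datum, (E) BY NAME** — the K4 RE-CLOSE sibling of abc-iut-w4-d012's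
`cor24_ii_iii'_tri_of_agreement`: as `cor24_ii_iii'_ofSpecialFibre_of_agreement_ofPiData` at `Π_{v▶} = Dec.Ptri`, input (E) being
the first conjunct of abc-iut-L6-t1's typed Def. 2.3 (i) predicate `Def23_i_indices Dec W`.  ZERO refuted-closure FACT heads.
[claim: Mochizuki2012, status: disputed] (IUTchII §2 Cor 2.4 (ii), kurims p.70) -/
theorem cor24_ii_iii'_tri_ofSpecialFibre_of_agreement_ofPiData (hDef : Def23_i_indices Dec W)
    (A : W.StableCurveAgreement Cu
      (StableCurveTemperedData.ofSpecialFibre X d Sf h36 Sigma SigmaHat hsub hne hprime hp TpH HatH hle cMH))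
    (hfi : (W.piV.subgroupOf W.piPM).index ≠ 0)
    (hlev : ∀ (Q I : Subgroup W.Corhat), Cu.IsCuspidalInertia Q I ↔
      I ≤ Q ∧ ∃ I₀ : Subgroup W.Corhat, Cu.IsCuspidalInertia W.piPM I₀ ∧ I = I₀ ⊓ Q)
    -- producer inputs for [IUTchI] Prop. 2.4 (i) at the datum
    (Tw : SpecialFibreTower X.DeltaTemp) (Pw : SpecialFibreTower.PiData X d Sf Tw)
    (hstf : (StableCurveTemperedData.ofSpecialFibre X d Sf h36 Sigma SigmaHat hsub hne hprime hp TpH HatH hle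
      cMH).StronglyTorsionFreeSigma)
    (Λv : ∀ i, (Tw.Gc i).graph.Vertex → Subgroup (Tw.chart i).G)
    (hΛv : ∀ i v, Λv i v ∈ verticialSubgroups (Tw.chart i) v)
    (E : ℕ → Type) (src tgt : ∀ i, E i → (Tw.Gc i).graph.Vertex) (c₁ c₂ : ∀ i, E i → (Tw.chart i).G)
    (hA3 : ∀ i (v w : (Tw.Gc i).graph.Vertex) (g h : (OfSpecialFibre.levelGraph X Tw Sigma SigmaHat hsub hne hprime i).Hat),
      MulAut.conj g • (Λv i v).map (OfSpecialFibre.levelGraph X Tw Sigma SigmaHat hsub hne hprime i).ι ⊓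
          MulAut.conj h • (Λv i w).map (OfSpecialFibre.levelGraph X Tw Sigma SigmaHat hsub hne hprime i).ι ≠ ⊥ →
        (v = w ∧ g⁻¹ * h ∈ (Λv i v).map (OfSpecialFibre.levelGraph X Tw Sigma SigmaHat hsub hne hprime i).ι) ∨
        ∃ (e : E i) (k : (OfSpecialFibre.levelGraph X Tw Sigma SigmaHat hsub hne hprime i).Hat),
          ∃ p ∈ (Λv i (src i e)).map (OfSpecialFibre.levelGraph X Tw Sigma SigmaHat hsub hne hprime i).ι,
          ∃ q ∈ (Λv i (tgt i e)).map (OfSpecialFibre.levelGraph X Tw Sigma SigmaHat hsub hne hprime i).ι,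
            (src i e = v ∧ tgt i e = w ∧
                g = k * (OfSpecialFibre.levelGraph X Tw Sigma SigmaHat hsub hne hprime i).ι (c₁ i e) * p ∧
                h = k * (OfSpecialFibre.levelGraph X Tw Sigma SigmaHat hsub hne hprime i).ι (c₂ i e) * q) ∨
            (src i e = w ∧ tgt i e = v ∧
                h = k * (OfSpecialFibre.levelGraph X Tw Sigma SigmaHat hsub hne hprime i).ι (c₁ i e) * p ∧
                g = k * (OfSpecialFibre.levelGraph X Tw Sigma SigmaHat hsub hne hprime i).ι (c₂ i e) * q))
    (hspec : (OfSpecialFibre.towerOfSpecialFibreTower X d Tw Sigma SigmaHat hsub hne hprime Sf h36 hp TpH HatH hle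
      cMH).SpecializationAb)
    (hadm : ∀ U ∈ 𝓝 (1 : ↥X.DeltaTemp), ∃ j, ((Tw.admKer j : Subgroup ↥X.DeltaTemp) : Set ↥X.DeltaTemp) ⊆ U)
    -- producer input for Cor. 2.3 (ii): `Π̂_ℍ` is the closure of `Π^tp_ℍ`
    (hHcl : ((StableCurveTemperedData.ofSpecialFibre X d Sf h36 Sigma SigmaHat hsub hne hprime hp TpH HatH hle cMH).graph.HatH :
        Set (StableCurveTemperedData.ofSpecialFibre X d Sf h36 Sigma SigmaHat hsub hne hprime hp TpH HatH hle cMH).graph.Hat) =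
      closure ((StableCurveTemperedData.ofSpecialFibre X d Sf h36 Sigma SigmaHat hsub hne hprime hp TpH HatH hle cMH).graph.ι ''
        (StableCurveTemperedData.ofSpecialFibre X d Sf h36 Sigma SigmaHat hsub hne hprime hp TpH HatH hle cMH).graph.TpH))
    -- producer input for Cor. 2.3 (v): `Π̂_ℍ ∩ Π^tp_𝔾 = Π^tp_ℍ`
    (hv : ((StableCurveTemperedData.ofSpecialFibre X d Sf h36 Sigma SigmaHat hsub hne hprime hp TpH HatH hle cMH).graph.HatH :
        Set (StableCurveTemperedData.ofSpecialFibre X d Sf h36 Sigma SigmaHat hsub hne hprime hp TpH HatH hle cMH).graph.Hat) ∩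
        Set.range (StableCurveTemperedData.ofSpecialFibre X d Sf h36 Sigma SigmaHat hsub hne hprime hp TpH HatH hle cMH).graph.ι =
      (StableCurveTemperedData.ofSpecialFibre X d Sf h36 Sigma SigmaHat hsub hne hprime hp TpH HatH hle cMH).graph.ι ''
        (StableCurveTemperedData.ofSpecialFibre X d Sf h36 Sigma SigmaHat hsub hne hprime hp TpH HatH hle cMH).graph.TpH)
    -- producer inputs for Cor. 2.3 (iii): Cor. 2.3 (i) of the datum (F-2592, conditional), slimness, outer stability
    (hi : (StableCurveTemperedData.ofSpecialFibre X d Sf h36 Sigma SigmaHat hsub hne hprime hp TpH HatH hle cMH).Cor23i)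
    (hslim : (StableCurveTemperedData.ofSpecialFibre X d Sf h36 Sigma SigmaHat hsub hne hprime hp TpH HatH hle cMH).Cor23Hyp →
      IsSlimGroup (StableCurveTemperedData.ofSpecialFibre X d Sf h36 Sigma SigmaHat hsub hne hprime hp TpH HatH hle
        cMH).deltaHatH)
    (hOutTp : ∀ g : (StableCurveTemperedData.ofSpecialFibre X d Sf h36 Sigma SigmaHat hsub hne hprime hp TpH HatH hle cMH).PiTp,
      ∃ δ : (StableCurveTemperedData.ofSpecialFibre X d Sf h36 Sigma SigmaHat hsub hne hprime hp TpH HatH hle cMH).DeltaTp,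
        MulAut.conj g • ((StableCurveTemperedData.ofSpecialFibre X d Sf h36 Sigma SigmaHat hsub hne hprime hp TpH HatH hle
            cMH).deltaTpH.map
          (StableCurveTemperedData.ofSpecialFibre X d Sf h36 Sigma SigmaHat hsub hne hprime hp TpH HatH hle
            cMH).DeltaTp.subtype) =
        MulAut.conj (δ : (StableCurveTemperedData.ofSpecialFibre X d Sf h36 Sigma SigmaHat hsub hne hprime hp TpH HatH hle
            cMH).PiTp) •
          ((StableCurveTemperedData.ofSpecialFibre X d Sf h36 Sigma SigmaHat hsub hne hprime hp TpH HatH hle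
              cMH).deltaTpH.map
            (StableCurveTemperedData.ofSpecialFibre X d Sf h36 Sigma SigmaHat hsub hne hprime hp TpH HatH hle
              cMH).DeltaTp.subtype))
    (hHyp : (StableCurveTemperedData.ofSpecialFibre X d Sf h36 Sigma SigmaHat hsub hne hprime hp TpH HatH hle cMH).Cor23Hyp)
    (Dic : ∀ H' : Subgroup P, Cor24_family Dec Ld H' → A.SubgraphDictionary H')
    (hBox : ((W.pmBox Dec.Ptri).subgroupOf W.pmHat).map A.eHat.toMonoidHom =
      (StableCurveTemperedData.ofSpecialFibre X d Sf h36 Sigma SigmaHat hsub hne hprime hp TpH HatH hle cMH).piTpXH.map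
        (StableCurveTemperedData.ofSpecialFibre X d Sf h36 Sigma SigmaHat hsub hne hprime hp TpH HatH hle cMH).ιX)
    (h23vi : ∀ I : Subgroup W.Corhat, Cu.IsCuspidalInertia W.piV I → ∀ H' : Subgroup P, Cor24_family Dec Ld H' →
      ∀ γ' : W.Corhat, γ' ∈ W.piPM ⊓ W.aug.ker →
        I.map (MulAut.conj γ').toMonoidHom ≤ W.pmBox H' → γ' ∈ closure (W.deltaPmBox H' : Set W.Corhat))
    (hYdd : ∀ I : Subgroup W.Corhat, Cu.IsCuspidalInertia W.piV I → I ≤ W.deltaBox Dec.Ptri →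
      W.cuspDecomp I 1 ≤ (T.YddL).map (W.emb.comp T.incl)) :
    Literature.IUT.HodgeArakelov.Cor24_ii_iii' W Cu Dec.Ptri :=
  cor24_ii_iii'_ofSpecialFibre_of_agreement_ofPiData Dec W Cu Ld Dec.Ptri (cor24_family_tri Dec W Cu Ld) A hfi hlev Tw Pw
    hstf Λv hΛv E src tgt c₁ c₂ hA3 hspec hadm hHcl hv hi hslim hOutTp hHyp Dic hBox h23vi
    (W.pmBox_inf_piV_le_box_of_def23_i_indices Dec hDef (Or.inr rfl)) hYdd

/-! ### §3 (v2, append-only). The node-level statement AT THE GENUINE DATUM with NO dictionary binder — per-admissible-`Π_{v□'}`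
special-fibre SUB-DATA (the shape of abc-iut-w5-d121/L5-t11's `cor24_i'_ofSpecialFibre`)

Since 18:25Z the ∀-closure of F-2734 `StableCurveAgreement.SubgraphDictionary` is REFUTED in the tree (abc-iut refuter
`exists_stableCurveAgreement_not_subgraphDictionary`): ONE agreement with ONE datum `ofSpecialFibre … Π_ℍ …` cannot carry Δ-dictionaries
for two distinct admissible `Π_{v□'}` — so the binder `Dic : ∀ H', Cor24_family … → A.SubgraphDictionary H'` of §2 (inherited verbatim
from `cor24_ii_iii'_of_agreement`) is of the vacuous-∀ shape (c312-2 K4 v4 19:32Z: node re-classed BLOCKED on F-2734).  §3 removes it: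
for EACH admissible `Π_{v□'}` the caller supplies special-fibre SUB-DATA `(Π_{ℍ'}, Π̂_{ℍ'}, hle', cuspMeetsH')` of the SAME curve with the
closure law `hHcl'`, the Δ-dictionary identity `hDic'` (an EQUATION, no FACT head) and «`Π̂_{ℍ'} ∩ Π^tp_𝔾 = Π^tp_{ℍ'}`» (`hv'`, ⟹ Cor. 2.3 (v)
by `cor23v_of_graph`) — exactly the `Dic` binder of `cor24_i'_ofSpecialFibre` with its F-2597 conjunct replaced by the producer input. -/

/-- **IUTchII:Cor2.4(ii)(iii)′ AT THE GENUINE DATUM, NO dictionary binder, EVERY refuted-closure head supplied** — abc-iut-w4-d012's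
assembly `cor24_ii_iii'_of_inputs` with Cor. 2.4 (i) for each cuspidal `I ⊆ Δ_{v□}` supplied by abc-iut-w5-d121/L5-t11's
`cor24_i'_ofSpecialFibre` (input (A) ⟸ Prop. 2.4 (i) of the datum ⟸ the Π-equivariant special-fibre tower producer; input (C) per
admissible `Π_{v□'}` ⟸ special-fibre SUB-DATA with `hHcl'` (⟹ Cor. 2.3 (ii)), `hDic'`, `hv'` (⟹ Cor. 2.3 (v)); input (B) = the open-subgroup
step `h23vi`, GAP-LEDGER G-w4d012-2); (S) `hsurj`, (E) `hcap`, (a.2) `hYdd` verbatim; `eHat` bicontinuous (`hA`, delivered at the genuine pair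
by `exists_of_isProfiniteCompletion_isHomeomorph`).  Binders: tower/agreement DATA, special-fibre DATA and sub-data, per-level producer
inputs, printed inline clauses — ZERO FACT-LIST heads of class refuted-closure (no F-1949, F-2593, F-2595, F-2597, F-2599, F-2734).
[claim: Mochizuki2012, status: disputed] (IUTchII §2 Cor 2.4 (ii), kurims p.70) -/
theorem cor24_ii_iii'_ofSpecialFibre_of_subgraphData_ofPiData (hH : Cor24_family Dec Ld H)
    (A : W.StableCurveAgreement Cu
      (StableCurveTemperedData.ofSpecialFibre X d Sf h36 Sigma SigmaHat hsub hne hprime hp TpH HatH hle cMH))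
    (hA : IsHomeomorph A.eHat)
    (hfi : (W.piV.subgroupOf W.piPM).index ≠ 0)
    (hlev : ∀ (Q I : Subgroup W.Corhat), Cu.IsCuspidalInertia Q I ↔
      I ≤ Q ∧ ∃ I₀ : Subgroup W.Corhat, Cu.IsCuspidalInertia W.piPM I₀ ∧ I = I₀ ⊓ Q)
    -- producer inputs for [IUTchI] Prop. 2.4 (i) at the datum
    (Tw : SpecialFibreTower X.DeltaTemp) (Pw : SpecialFibreTower.PiData X d Sf Tw)
    (hstf : (StableCurveTemperedData.ofSpecialFibre X d Sf h36 Sigma SigmaHat hsub hne hprime hp TpH HatH hle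
      cMH).StronglyTorsionFreeSigma)
    (Λv : ∀ i, (Tw.Gc i).graph.Vertex → Subgroup (Tw.chart i).G)
    (hΛv : ∀ i v, Λv i v ∈ verticialSubgroups (Tw.chart i) v)
    (E : ℕ → Type) (src tgt : ∀ i, E i → (Tw.Gc i).graph.Vertex) (c₁ c₂ : ∀ i, E i → (Tw.chart i).G)
    (hA3 : ∀ i (v w : (Tw.Gc i).graph.Vertex) (g h : (OfSpecialFibre.levelGraph X Tw Sigma SigmaHat hsub hne hprime i).Hat),
      MulAut.conj g • (Λv i v).map (OfSpecialFibre.levelGraph X Tw Sigma SigmaHat hsub hne hprime i).ι ⊓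
          MulAut.conj h • (Λv i w).map (OfSpecialFibre.levelGraph X Tw Sigma SigmaHat hsub hne hprime i).ι ≠ ⊥ →
        (v = w ∧ g⁻¹ * h ∈ (Λv i v).map (OfSpecialFibre.levelGraph X Tw Sigma SigmaHat hsub hne hprime i).ι) ∨
        ∃ (e : E i) (k : (OfSpecialFibre.levelGraph X Tw Sigma SigmaHat hsub hne hprime i).Hat),
          ∃ p ∈ (Λv i (src i e)).map (OfSpecialFibre.levelGraph X Tw Sigma SigmaHat hsub hne hprime i).ι,
          ∃ q ∈ (Λv i (tgt i e)).map (OfSpecialFibre.levelGraph X Tw Sigma SigmaHat hsub hne hprime i).ι,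
            (src i e = v ∧ tgt i e = w ∧
                g = k * (OfSpecialFibre.levelGraph X Tw Sigma SigmaHat hsub hne hprime i).ι (c₁ i e) * p ∧
                h = k * (OfSpecialFibre.levelGraph X Tw Sigma SigmaHat hsub hne hprime i).ι (c₂ i e) * q) ∨
            (src i e = w ∧ tgt i e = v ∧
                h = k * (OfSpecialFibre.levelGraph X Tw Sigma SigmaHat hsub hne hprime i).ι (c₁ i e) * p ∧
                g = k * (OfSpecialFibre.levelGraph X Tw Sigma SigmaHat hsub hne hprime i).ι (c₂ i e) * q))
    (hspec : (OfSpecialFibre.towerOfSpecialFibreTower X d Tw Sigma SigmaHat hsub hne hprime Sf h36 hp TpH HatH hle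
      cMH).SpecializationAb)
    (hadm : ∀ U ∈ 𝓝 (1 : ↥X.DeltaTemp), ∃ j, ((Tw.admKer j : Subgroup ↥X.DeltaTemp) : Set ↥X.DeltaTemp) ⊆ U)
    -- per-admissible-subgroup special-fibre SUB-DATA («ℍ = Γ_□'», print p. 70) with the producer inputs for Cor. 2.3 (ii)/(v)
    (Sub : ∀ H' : Subgroup P, Cor24_family Dec Ld H' →
      ∃ (TpH' : Subgroup Sf.chart.G)
        (HatH' : Subgroup (TemperedGraphGroupData.exists_completion_of_prop36 Sf.Gc h36 Sf.chart).choose)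
        (hle' : TpH'.map (TemperedGraphGroupData.exists_completion_of_prop36 Sf.Gc h36
          Sf.chart).choose_spec.choose.toMonoidHom ≤ HatH')
        (cMH' : {x : X.Pt // X.IsCusp x} → Prop),
        ((StableCurveTemperedData.ofSpecialFibre X d Sf h36 Sigma SigmaHat hsub hne hprime hp TpH' HatH' hle' cMH').graph.HatH :
            Set (StableCurveTemperedData.ofSpecialFibre X d Sf h36 Sigma SigmaHat hsub hne hprime hp TpH' HatH' hle' cMH').graph.Hat) =
          closure ((StableCurveTemperedData.ofSpecialFibre X d Sf h36 Sigma SigmaHat hsub hne hprime hp TpH' HatH' hle' cMH').graph.ι ''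
            (StableCurveTemperedData.ofSpecialFibre X d Sf h36 Sigma SigmaHat hsub hne hprime hp TpH' HatH' hle' cMH').graph.TpH) ∧
        ((W.deltaPmBox H').subgroupOf W.pmHat).map A.eHat.toMonoidHom =
          ((StableCurveTemperedData.ofSpecialFibre X d Sf h36 Sigma SigmaHat hsub hne hprime hp TpH' HatH' hle' cMH').deltaTpH.map
            (StableCurveTemperedData.ofSpecialFibre X d Sf h36 Sigma SigmaHat hsub hne hprime hp TpH' HatH' hle' cMH').ιΔ).map
            (StableCurveTemperedData.ofSpecialFibre X d Sf h36 Sigma SigmaHat hsub hne hprime hp TpH' HatH' hle' cMH').DeltaHat.subtype ∧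
        ((StableCurveTemperedData.ofSpecialFibre X d Sf h36 Sigma SigmaHat hsub hne hprime hp TpH' HatH' hle' cMH').graph.HatH :
            Set (StableCurveTemperedData.ofSpecialFibre X d Sf h36 Sigma SigmaHat hsub hne hprime hp TpH' HatH' hle' cMH').graph.Hat) ∩
            Set.range (StableCurveTemperedData.ofSpecialFibre X d Sf h36 Sigma SigmaHat hsub hne hprime hp TpH' HatH' hle'
              cMH').graph.ι =
          (StableCurveTemperedData.ofSpecialFibre X d Sf h36 Sigma SigmaHat hsub hne hprime hp TpH' HatH' hle' cMH').graph.ι ''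
            (StableCurveTemperedData.ofSpecialFibre X d Sf h36 Sigma SigmaHat hsub hne hprime hp TpH' HatH' hle' cMH').graph.TpH)
    -- the open-subgroup step (B), GAP-LEDGER G-w4d012-2, per cuspidal `I` and admissible `Π_{v□'}`
    (h23vi : ∀ I : Subgroup W.Corhat, Cu.IsCuspidalInertia W.piV I → ∀ H' : Subgroup P, Cor24_family Dec Ld H' →
      ∀ γ' : W.Corhat, γ' ∈ W.piPM ⊓ W.aug.ker →
        I.map (MulAut.conj γ').toMonoidHom ≤ W.pmBox H' → γ' ∈ closure (W.deltaPmBox H' : Set W.Corhat))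
    (hsurj : ∀ n : W.Corhat, n ∈ W.piV → ∃ m : W.Corhat, m ∈ W.pmBox H ∧ m⁻¹ * n ∈ W.aug.ker)
    (hcap : W.pmBox H ⊓ W.piV ≤ W.box H)
    (hYdd : ∀ I : Subgroup W.Corhat, Cu.IsCuspidalInertia W.piV I → I ≤ W.deltaBox H →
      W.cuspDecomp I 1 ≤ (T.YddL).map (W.emb.comp T.incl)) :
    Literature.IUT.HodgeArakelov.Cor24_ii_iii' W Cu H :=
  have h24i : (StableCurveTemperedData.ofSpecialFibre X d Sf h36 Sigma SigmaHat hsub hne hprime hp TpH HatH hle cMH).Prop24i :=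
    OfSpecialFibre.prop24i_ofPiData_of_admKer_nhds_one X d Tw Sigma SigmaHat hsub hne hprime Sf h36 hp TpH HatH hle cMH Pw
      hstf Λv hΛv E src tgt c₁ c₂ hA3 hspec hadm
  cor24_ii_iii'_of_inputs
    (fun I hI hIΔ => cor24_i'_ofSpecialFibre Dec W Cu Ld hfi hlev A hA h24i hI (hIΔ.trans inf_le_right)
      (fun H' hH' => by
        obtain ⟨TpH', HatH', hle', cMH', hHcl', hDic', hv'⟩ := Sub H' hH'
        exact ⟨TpH', HatH', hle', cMH', hHcl', hDic',
          (StableCurveTemperedData.ofSpecialFibre X d Sf h36 Sigma SigmaHat hsub hne hprime hp TpH' HatH' hle'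
            cMH').cor23v_of_graph hv'⟩)
      (h23vi I hI) H hH)
    hsurj hcap hYdd

end OfSpecialFibre

end Literature.IUT.HodgeArakelov

end
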